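import Summits.QuantumFields.GaugeBoot.PlanarCertificateResolvedTorus
import Summits.QuantumFields.GaugeBoot.ZdLoopEquationSU2
import HarnessLib

/-!
# The exact finite-`N` content of a planar certificate for `SU(N)`: planar rows + two correction columns + the resolved block (gauge-boot, large-`N` supplement 21)

HONEST FRAMING (cell `pub-gaugeboot`, page 1 of every file): the venture produces certified bounds
on lattice expectations at stated coupling, gauge group, dimension and torus size; NOT a mass gap,
NOT a continuum limit, NOT a string tension; NOT large `N` unless marked CONDITIONAL; NOT
Yang–Mills-summit-bearing (barriers `FixedCouplingUltralocality`, `PerturbativeInvisibility`).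
This file says which modification of a planar certificate is an EXACT finite-`N` certificate for
`SU(N)`; it certifies no number and no such certificate of the cell is in the tree in this format.

## Content

Supplement 16 showed: orientation-resolved planar certificates are exactly sound for `U(N)`; for `SU(N)`
the planar rows keep the defects `((#fwd − #bwd)/N²) W(w) − (β/N) Σ_{ν,ε} Γ(w, P̃_{ν,ε})` of supplement 3.
Both are LINEAR in orientation-resolved pair data: `Γ(w, P̃) = (Q(w, P̃⁻¹) − Q(w, P̃))/2`
(supplement 2).  So the finite-`N` `SU(N)` row is the planar row plus TWO CORRECTION COLUMNS,

`suNRow βt κ a w W Q = planarRow βt a w W Q − κ (#fwd − #bwd) W(w) + (βt/2) Σ_{ν ≠ a} Σ_ε (Q(w, P̃⁻¹) − Q(w, P̃))`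

with `κ = 1/N²` (`suNCorrection`; the tree's `loopEquation_pairForm` with `s = 1`, rearranged), and:

* ★★ `suNRow_loopData_suN` — **the corrected row holds EXACTLY** on the data of every finite Haar-shift
  state of the `SU(N)` Wilson action on `ℤ^d` at tree coupling `β` (`βt = β/N`, `κ = 1/N²`); torus:
  `suNRow_loopDataT_suN` for the `SU(N)` torus Wilson state at every `(N, β, L)`.
* `PlanarCertificate.IsValidSuN κ` — validity of the SAME certificate data with rows `suNRow βt κ` and
  the orientation-resolved relaxation block (supplement 16); ★ `rhsSuN_sub_rhsResolved` — it differs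
  from the resolved planar identity by `Σ_r y_r · suNCorrection_r` (two columns per row).
* ★★★ `PlanarCertificate.obj_loopW_le_suN_finiteN` — **EXACT SOUNDNESS FOR `SU(N)` AT THE CERTIFICATE'S
  `N`**: `IsValidSuN (1/N²)`, `βt = β/N` ⇒ `obj(W_μ) ≤ bound` for every probability Haar-shift state on
  `ℤ^d` (DLR states, thermodynamic limit points) satisfying the identification rows — no defect, every
  real `β`; ★★★ `obj_loopWT_le_suN_finiteN` — the same for the `SU(N)` torus Wilson state at every
  `(N, β, L)` (rows small for the torus): the cell's objects.

So, read at finite `N`, a Kazakov–Zheng planar certificate for `SU(N)` is EXACTLY: an `IsValidSuN (1/N²)`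
certificate (sound on the nose) in which (i) the `κ = 1/N²` column is dropped, (ii) the plaquette pairs
`Q(w, P̃) ≡ Q(w, P̃⁻¹)` of the rows and (iii) the pairs `Q(ℓ_A, ℓ_B) ≡ Q(ℓ_A, ℓ_B⁻¹)` of the relaxation
block are identified across a SEPARATE orientation reversal, and (iv) loops are identified by class —
and the large-`N` hypothesis pays exactly for (i)–(iv) (supplements 16–20).  NOT claimed: that the
cell's finite-`N` generators emit this format (they keep pair variables `d(A,B)` and their own rows,
`LoopEquationPairForm`); anything numerical.  [folklore] bookkeeping; Kazakov–Zheng arXiv:2203.11360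
§2–3, arXiv:2404.16925 §2 (finite-`N` loop equations).
-/

noncomputable section

open MeasureTheory
open scoped BigOperators
open Literature.Probability.LatticeModels (Site)
open Literature.MathematicalPhysics.QuantumLattice
open Literature.MathematicalPhysics.QuantumFieldTheory (GaugeConfig wilsonMeasure isProbabilityMeasure_wilsonMeasure)

namespace Summit.QuantumFields.GaugeBoot

variable {d N : ℕ}

/-! ## The two correction columns and the finite-`N` `SU(N)` row -/

/-- **The `SU(N)` correction columns of the marked word `w` at axis `a`**: the length term
`−κ (#fwd − #bwd) W(w)` (`κ = 1/N²`) and the orientation pairs of the plaquette words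
`(βt/2) Σ_{ν ≠ a} Σ_ε (Q(w, P̃⁻¹) − Q(w, P̃))` — linear in orientation-resolved pair data. [folklore] -/
def suNCorrection (βt κ : ℝ) (a : Fin d) (w : Word d) (W : Word d → ℝ) (Q : Word d → Word d → ℝ) : ℝ :=
  -κ * ((((Finset.range w.length).filter (w.fwdOccZ a)).card : ℝ) - ((Finset.range w.length).filter (w.bwdOccZ a)).card) * W w +
    βt / 2 * ∑ ν ∈ Finset.univ.erase a, ∑ ε : Bool, (Q w (plaqWord a ν ε).reverse - Q w (plaqWord a ν ε))

/-- **The finite-`N` `SU(N)` row** of the marked word `w` at axis `a`: the planar row plus the two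
correction columns (the tree's `loopEquation_pairForm`, `s = 1`, in planar-certificate variables).
[folklore] -/
def suNRow (βt κ : ℝ) (a : Fin d) (w : Word d) (W : Word d → ℝ) (Q : Word d → Word d → ℝ) : ℝ :=
  planarRow βt a w W Q + suNCorrection βt κ a w W Q

/-- ★★ **THE CORRECTED ROW HOLDS EXACTLY FOR `SU(N)` AT EVERY `N`**: for every real `β`, every finite
Haar-shift state `μ` of the `SU(N)` Wilson action on `ℤ^d`, every marked closed word:
`suNRow (β/N) (1/N²) a w (loopW μ) (loopQ μ) = 0`. [folklore] -/
theorem suNRow_loopData_suN {β : ℝ} {μ : Measure (LGConfig d (Matrix.specialUnitaryGroup (Fin N) ℂ))}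
    [IsFiniteMeasure μ] (hμ : IsHaarShiftState (fundamentalRep (Fin N)) β μ) (x : Site d) (a : Fin d) (w : Word d)
    (hw : Word.endpointZd x w = x) :
    suNRow (β / N) (1 / (N : ℝ) ^ 2) a w (loopW (fundamentalRep (Fin N)) μ x) (loopQ (fundamentalRep (Fin N)) μ x) = 0 := by
  rw [suNRow, suNCorrection, planarRow_loopData_suN hμ x a w hw]
  have hP : ∀ ν ε, loopQ (fundamentalRep (Fin N)) μ x w (plaqWord a ν ε).reverse - loopQ (fundamentalRep (Fin N)) μ x w (plaqWord a ν ε) =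
      2 * loopImCov (fundamentalRep (Fin N)) μ x w (plaqWord a ν ε) := fun ν ε =>
    loopQ_reverse_sub_loopQ _ (continuous_fundamentalRep (Fin N)) μ x w (Word.endpointZd_plaqWord x a ν ε)
  simp only [hP, ← Finset.mul_sum]
  ring

/-! ## The corrected row on the torus -/

section TorusRow

variable {L : ℕ} [NeZero L]

/-- ★★ **The corrected row holds EXACTLY for the `SU(N)` torus Wilson state** at every `(N, β, L)`, for a
closed word small for the torus. [folklore] -/
theorem suNRow_loopDataT_suN (β : ℝ) (x : Literature.MathematicalPhysics.QuantumFieldTheory.Site d L) (a : Fin d) (w : Word d)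
    (hw : Word.endpoint x w = x) (hsm : w.Small L) :
    suNRow (β / N) (1 / (N : ℝ) ^ 2) a w (loopWT (fundamentalRep (Fin N)) (wilsonMeasure (d := d) (L := L) (fundamentalRep (Fin N)) β) x)
      (loopQT (fundamentalRep (Fin N)) (wilsonMeasure (d := d) (L := L) (fundamentalRep (Fin N)) β) x) = 0 := by
  haveI := isProbabilityMeasure_wilsonMeasure (d := d) (L := L) (G := Matrix.specialUnitaryGroup (Fin N) ℂ)
    (fundamentalRep (Fin N)) (continuous_fundamentalRep (Fin N)) β
  rw [suNRow, suNCorrection, planarRow_loopDataT_suN β x a w hw hsm]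
  have hP : ∀ ν ε, loopQT (fundamentalRep (Fin N)) (wilsonMeasure (d := d) (L := L) (fundamentalRep (Fin N)) β) x w (plaqWord a ν ε).reverse -
      loopQT (fundamentalRep (Fin N)) (wilsonMeasure (d := d) (L := L) (fundamentalRep (Fin N)) β) x w (plaqWord a ν ε) =
        2 * loopImCovT (fundamentalRep (Fin N)) (wilsonMeasure (d := d) (L := L) (fundamentalRep (Fin N)) β) x w (plaqWord a ν ε) :=
    fun ν ε => by
      have h := loopQT_sub_loopQT_reverse _ (continuous_fundamentalRep (Fin N))
        (wilsonMeasure (d := d) (L := L) (fundamentalRep (Fin N)) β) x w (endpoint_plaqWord x a ν ε)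
      linarith
  simp only [hP, ← Finset.mul_sum]
  ring

end TorusRow

/-! ## The finite-`N` `SU(N)` certificate identity -/

namespace PlanarCertificate

variable (P : PlanarCertificate d)

/-- The right-hand side with the finite-`N` `SU(N)` rows (`κ = 1/N²`) and the orientation-resolved
relaxation block. [folklore] -/
def rhsSuN (κ : ℝ) (W : Word d → ℝ) (Q : Word d → Word d → ℝ) : ℝ :=
  (∑ r, P.rowMult r * suNRow P.βt κ (P.rowAxis r) (P.rowWord r) W Q) +
    (∑ j, gramPairing (P.gramWord j) (P.gramVec j) W) +
    (∑ s, P.shorTermResolved s W Q) +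
    ∑ e, P.linMult e * P.lin e W Q

/-- **Finite-`N` `SU(N)` validity** (`κ = 1/N²` names the `N`): `bound − obj(W) = rhsSuN κ (W, Q)` for
ALL planar data (what a checker verifies). [folklore] -/
def IsValidSuN (κ : ℝ) : Prop := ∀ (W : Word d → ℝ) (Q : Word d → Word d → ℝ), P.bound - P.obj W = P.rhsSuN κ W Q

/-- ★ **The dictionary**: the finite-`N` `SU(N)` identity is the resolved planar identity plus the two
correction columns of each row, `rhsSuN κ − rhsResolved = Σ_r y_r · suNCorrection_r`. [folklore] -/
theorem rhsSuN_sub_rhsResolved (κ : ℝ) (W : Word d → ℝ) (Q : Word d → Word d → ℝ) :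
    P.rhsSuN κ W Q - P.rhsResolved W Q = ∑ r, P.rowMult r * suNCorrection P.βt κ (P.rowAxis r) (P.rowWord r) W Q := by
  rw [rhsSuN, rhsResolved]
  have h : (∑ r, P.rowMult r * suNRow P.βt κ (P.rowAxis r) (P.rowWord r) W Q) -
      ∑ r, P.rowMult r * planarRow P.βt (P.rowAxis r) (P.rowWord r) W Q =
      ∑ r, P.rowMult r * suNCorrection P.βt κ (P.rowAxis r) (P.rowWord r) W Q := by
    rw [← Finset.sum_sub_distrib]
    exact Finset.sum_congr rfl fun r _ => by rw [suNRow]; ring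
  linarith

/-- **On `SU(N)` data the correction of a row is minus its planar defect**: for a finite Haar-shift state
at tree coupling `β`, `suNCorrection (β/N) (1/N²) a w = −planarRow (β/N) a w` on `(loopW μ, loopQ μ)`.
[folklore] -/
theorem suNCorrection_loopData_eq_neg_planarRow {β : ℝ} {μ : Measure (LGConfig d (Matrix.specialUnitaryGroup (Fin N) ℂ))}
    [IsFiniteMeasure μ] (hμ : IsHaarShiftState (fundamentalRep (Fin N)) β μ) (x : Site d) (a : Fin d) (w : Word d)
    (hw : Word.endpointZd x w = x) :
    suNCorrection (β / N) (1 / (N : ℝ) ^ 2) a w (loopW (fundamentalRep (Fin N)) μ x) (loopQ (fundamentalRep (Fin N)) μ x) =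
      -planarRow (β / N) a w (loopW (fundamentalRep (Fin N)) μ x) (loopQ (fundamentalRep (Fin N)) μ x) := by
  have h := suNRow_loopData_suN hμ x a w hw
  rw [suNRow] at h
  linarith

/-- **The abstract transfer for the finite-`N` `SU(N)` format**: rows valid EXACTLY, Gram blocks `≥ 0`,
resolved relaxation terms `≥ 0`, identification rows up to `η_e` ⇒ `obj ≤ bound + Σ_e |z_e| η_e`.
[folklore] -/
theorem obj_le_of_defects_suN {κ : ℝ} (hP : P.IsValidSuN κ) (W : Word d → ℝ) (Q : Word d → Word d → ℝ) (η : Fin P.nE → ℝ)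
    (hrow : ∀ r, suNRow P.βt κ (P.rowAxis r) (P.rowWord r) W Q = 0)
    (hgram : ∀ j, 0 ≤ gramPairing (P.gramWord j) (P.gramVec j) W)
    (hshor : ∀ s, 0 ≤ P.shorTermResolved s W Q) (hlin : ∀ e, |P.lin e W Q| ≤ η e) :
    P.obj W ≤ P.bound + ∑ e, |P.linMult e| * η e := by
  have h := hP W Q
  simp only [rhsSuN, hrow, mul_zero, Finset.sum_const_zero, zero_add] at h
  have h1 : 0 ≤ ∑ j, gramPairing (P.gramWord j) (P.gramVec j) W := Finset.sum_nonneg fun j _ => hgram j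
  have h2 : 0 ≤ ∑ s, P.shorTermResolved s W Q := Finset.sum_nonneg fun s _ => hshor s
  have h4 : -(∑ e, |P.linMult e| * η e) ≤ ∑ e, P.linMult e * P.lin e W Q := by
    rw [← Finset.sum_neg_distrib]
    refine Finset.sum_le_sum fun e _ => ?_
    have := abs_le.1 ((abs_mul _ _).le.trans (mul_le_mul_of_nonneg_left (hlin e) (abs_nonneg (P.linMult e))))
    linarith [this.1]
  linarith

/-! ## Exact soundness for `SU(N)` on `ℤ^d` -/

/-- ★★★ **A FINITE-`N` `SU(N)` CERTIFICATE IS EXACTLY SOUND**: for `P` with `IsValidSuN (1/N²)` at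
`βt = β/N`, every probability Haar-shift state `μ` of the `SU(N)` Wilson action on `ℤ^d` at tree coupling
`β` (DLR states, thermodynamic limit points, Class-B states) satisfying the identification rows — rows,
Gram words and relaxation loops closed at `x` — obeys `obj(W_μ) ≤ bound`.  No defect, every real `β`.
[folklore] -/
theorem obj_loopW_le_suN_finiteN (hP : P.IsValidSuN (1 / (N : ℝ) ^ 2)) {β : ℝ} (hβ : β / N = P.βt)
    {μ : Measure (LGConfig d (Matrix.specialUnitaryGroup (Fin N) ℂ))} [IsProbabilityMeasure μ]
    (hμ : IsHaarShiftState (fundamentalRep (Fin N)) β μ) (x : Site d)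
    (hrow : ∀ r, Word.endpointZd x (P.rowWord r) = x) (hgram : ∀ j i, Word.endpointZd x (P.gramWord j i) = x)
    (hS : ∀ A, Word.endpointZd x (P.shorLoop A) = x)
    (hlin : ∀ e, P.lin e (loopW (fundamentalRep (Fin N)) μ x) (loopQ (fundamentalRep (Fin N)) μ x) = 0) :
    P.obj (loopW (fundamentalRep (Fin N)) μ x) ≤ P.bound := by
  have h := P.obj_le_of_defects_suN hP _ _ (fun _ => 0)
    (fun r => by rw [← hβ]; exact suNRow_loopData_suN hμ x (P.rowAxis r) (P.rowWord r) (hrow r))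
    (fun j => gramPairing_loopW_nonneg _ (continuous_fundamentalRep (Fin N)) μ x _ (hgram j) _)
    (P.shorTermResolved_loopData_nonneg _ (continuous_fundamentalRep (Fin N)) μ x hS)
    (fun e => by rw [hlin e, abs_zero])
  simpa using h

/-- ★★★ **… for every infinite-volume DLR state of `SU(N)`** (every real tree coupling `β`). [folklore] -/
theorem obj_loopW_le_suN_finiteN_of_mem_ymGibbsMeasures (hP : P.IsValidSuN (1 / (N : ℝ) ^ 2)) {β : ℝ} (hβ : β / N = P.βt)
    {μ : Measure (LGConfig d (Matrix.specialUnitaryGroup (Fin N) ℂ))}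
    (hμ : μ ∈ ymGibbsMeasures (d := d) (fundamentalRep (Fin N)) β) (x : Site d)
    (hrow : ∀ r, Word.endpointZd x (P.rowWord r) = x) (hgram : ∀ j i, Word.endpointZd x (P.gramWord j i) = x)
    (hS : ∀ A, Word.endpointZd x (P.shorLoop A) = x)
    (hlin : ∀ e, P.lin e (loopW (fundamentalRep (Fin N)) μ x) (loopQ (fundamentalRep (Fin N)) μ x) = 0) :
    P.obj (loopW (fundamentalRep (Fin N)) μ x) ≤ P.bound := by
  haveI : SecondCountableTopology (Matrix (Fin N) (Fin N) ℂ) :=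
    inferInstanceAs (SecondCountableTopology (Fin N → Fin N → ℂ))
  haveI : SecondCountableTopology (Matrix.specialUnitaryGroup (Fin N) ℂ) :=
    Topology.IsEmbedding.subtypeVal.secondCountableTopology
  haveI : IsProbabilityMeasure μ := hμ.1
  exact P.obj_loopW_le_suN_finiteN hP hβ (isHaarShiftState_of_mem_ymGibbsMeasures (fundamentalRep (Fin N))
    (continuous_fundamentalRep (Fin N)) hμ) x hrow hgram hS hlin

/-- ★★★ **… for every thermodynamic limit point of the `SU(N)` torus Wilson states.** [folklore] -/
theorem obj_loopW_le_suN_finiteN_of_mem_infiniteVolumeLimitPoints (hP : P.IsValidSuN (1 / (N : ℝ) ^ 2)) {β : ℝ}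
    (hβ : β / N = P.βt) {μ : Measure (LGConfig d (Matrix.specialUnitaryGroup (Fin N) ℂ))}
    (hμ : μ ∈ infiniteVolumeLimitPoints (d := d) (fundamentalRep (Fin N)) β) (x : Site d)
    (hrow : ∀ r, Word.endpointZd x (P.rowWord r) = x) (hgram : ∀ j i, Word.endpointZd x (P.gramWord j i) = x)
    (hS : ∀ A, Word.endpointZd x (P.shorLoop A) = x)
    (hlin : ∀ e, P.lin e (loopW (fundamentalRep (Fin N)) μ x) (loopQ (fundamentalRep (Fin N)) μ x) = 0) :
    P.obj (loopW (fundamentalRep (Fin N)) μ x) ≤ P.bound := by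
  haveI : SecondCountableTopology (Matrix (Fin N) (Fin N) ℂ) :=
    inferInstanceAs (SecondCountableTopology (Fin N → Fin N → ℂ))
  haveI : SecondCountableTopology (Matrix.specialUnitaryGroup (Fin N) ℂ) :=
    Topology.IsEmbedding.subtypeVal.secondCountableTopology
  exact P.obj_loopW_le_suN_finiteN_of_mem_ymGibbsMeasures hP hβ
    (mem_ymGibbsMeasures_of_mem_infiniteVolumeLimitPoints_holds (fundamentalRep (Fin N))
      (continuous_fundamentalRep (Fin N)) hμ) x hrow hgram hS hlin

/-! ## Exact soundness for the `SU(N)` torus Wilson state — the cell's objects -/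

section Torus

variable {L : ℕ} [NeZero L]

/-- ★★★ **A FINITE-`N` `SU(N)` CERTIFICATE IS EXACTLY SOUND FOR THE `SU(N)` TORUS WILSON STATE AT
`(N, β, L)`** (`IsValidSuN (1/N²)`, `βt = β/N`; rows closed and small for the torus, Gram words and
relaxation loops closed, identification rows valid on the data): `obj(⟨W⟩_{N,β,L}) ≤ bound`. [folklore] -/
theorem obj_loopWT_le_suN_finiteN (hP : P.IsValidSuN (1 / (N : ℝ) ^ 2)) {β : ℝ} (hβ : β / N = P.βt)
    (x : Literature.MathematicalPhysics.QuantumFieldTheory.Site d L)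
    (hrow : ∀ r, Word.endpoint x (P.rowWord r) = x) (hsm : ∀ r, (P.rowWord r).Small L)
    (hgram : ∀ j i, Word.endpoint x (P.gramWord j i) = x) (hS : ∀ A, Word.endpoint x (P.shorLoop A) = x)
    (hlin : ∀ e, P.lin e (loopWT (fundamentalRep (Fin N)) (wilsonMeasure (d := d) (L := L) (fundamentalRep (Fin N)) β) x)
      (loopQT (fundamentalRep (Fin N)) (wilsonMeasure (d := d) (L := L) (fundamentalRep (Fin N)) β) x) = 0) :
    P.obj (loopWT (fundamentalRep (Fin N)) (wilsonMeasure (d := d) (L := L) (fundamentalRep (Fin N)) β) x) ≤ P.bound := by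
  haveI := isProbabilityMeasure_wilsonMeasure (d := d) (L := L) (G := Matrix.specialUnitaryGroup (Fin N) ℂ)
    (fundamentalRep (Fin N)) (continuous_fundamentalRep (Fin N)) β
  have h := P.obj_le_of_defects_suN hP _ _ (fun _ => 0)
    (fun r => by rw [← hβ]; exact suNRow_loopDataT_suN (N := N) β x (P.rowAxis r) (P.rowWord r) (hrow r) (hsm r))
    (fun j => gramPairing_loopWT_nonneg _ (continuous_fundamentalRep (Fin N)) β x _ (hgram j) _)
    (P.shorTermResolved_loopDataT_nonneg _ (continuous_fundamentalRep (Fin N)) _ x hS)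
    (fun e => by rw [hlin e, abs_zero])
  simpa using h

end Torus

end PlanarCertificate

end Summit.QuantumFields.GaugeBoot

end
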